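import Summits.Ventures.YMGap.RobustBall.MassGapOnBallMassive
import Summits.Ventures.YMGap.RobustBall.UniformMassGapKR
import Summits.Ventures.YMGap.RobustBall.LatticeSumL1
import Summits.Ventures.YMGap.Thresholds.PlaquetteSusceptibility
import HarnessLib

/-!
# Venture YMGap, track ROBUST-BALL — THE ZERO-MOMENTUM (TIMESLICE-SUMMED) CORRELATOR: summed exponential clustering
# over every set of translations far from the origin, for every massive state

HONEST FRAMING. WHAT THIS IS: a venture file (cell `pub-ymgap`, track Y2 ROBUST-BALL, seat ds-3, theorems only). The cell's
massive rows (`IsMassiveState μ`: every truncated correlation `x ↦ cov_μ(F₁, F₂∘θ_x)` of bounded measurable gauge-invariant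
local observables `HasExponentialDecayRate · m` in the sup norm of `ℤ⁴`) are POINTWISE statements in the translation `x`.
What a lattice simulation fits a mass to is the ZERO-MOMENTUM correlator — the correlation SUMMED over a whole timeslice
`{x : x_i = t}`. This file proves the bookkeeping between the two, as a lattice-sum statement:

* GENERIC (`sum_abs_le_of_hasExponentialDecayRate`, every `d ≥ 1`): if `G : ℤ^d → ℝ` has `|G x| ≤ C e^{−m‖x‖_∞}`, then for
  every `0 < θ < 1`, every `t` and EVERY finite set `F` of sites with `‖x‖_∞ ≥ t` on `F`:
  `Σ_{x∈F} |G x| ≤ max(C,0) · ((1+r)/(1−r))^d · e^{−(1−θ) m t}`, `r = e^{−θ m / d}` — uniformly in `F` (timeslices,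
  shells, half-spaces); hence absolute summability over every such infinite set with the same bound
  (`tsum_abs_le_of_hasExponentialDecayRate`), and for the timeslices `{x : x_i = t}`
  (`timeslice_tsum_abs_le_of_hasExponentialDecayRate`, `‖x‖_∞ ≥ |x_i|`);
* MASSIVE STATES (`timeslice_correlator_decay_of_isMassiveState`, `d = 4`): for every massive state `μ` with rate `m`
  and all bounded measurable gauge-invariant local `F₁, F₂`, the timeslice-summed truncated correlator
  `C_i(t) = Σ_{x : x_i = t} cov_μ(F₁, F₂∘θ_x)` converges absolutely and `|C_i(t)| ≤ A_θ e^{−(1−θ) m |t|}` for every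
  `0 < θ < 1`: the zero-momentum correlator decays at every rate below the clustering rate (an «effective-mass» LOWER
  bound `≥ m` in the lattice sense); cell: `SU(2)` on `ℤ⁴`, every DLR state of every member of the tier-1 ball
  `MemBallZd ε₀ ε₁ R` at `6|β_W|e^{ε₀} + e^{ε₀/2}√(2/3)ε₁ < 1` (`su2_timeslice_correlator_decay_onBallZd`);
* EXPLICIT RATES: the Wilson point `SU(2)`, `ℤ⁴`, `0 ≤ β_W ≤ 1/12` — every rate below `log 2`
  (`su2_wilson_timeslice_correlator_decay_upTo_oneTwelfth`, from rb-p1's `su2_wilson_clustering_upTo_oneTwelfth`), and the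
  whole tier-1 ball from C-UNIF (`timeslice_correlator_decay_of_uniformMassGapOnBallZd`).
WHAT THIS IS NOT: not a transfer-matrix spectral statement (no reflection positivity is used or claimed), not an upper
bound on the mass, nothing at the Y3 crossover couplings; lattice strong coupling; nothing about the continuum or Clay.

References (mechanism): B. Simon, *The Statistical Mechanics of Lattice Gases* I (1993), §II.12; I. Montvay, G. Münster,
*Quantum Fields on a Lattice* (1994), §3.7 (timeslice correlators and masses); the tree's `LatticeSumL1.lean`.
-/

noncomputable section

open MeasureTheory Filter Function ProbabilityTheory Real
open scoped NNReal
open Literature.Probability.LatticeModels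
open Literature.MathematicalPhysics.QuantumLattice
open Literature.MathematicalPhysics.QuantumFieldTheory hiding ZdEdge Site IsLocalObservable
open Literature.Barriers.QuantumFields (IsMassiveState)
open Summit.Ventures.YMGap.PlaquetteSusceptibility (l1_le_mul_norm)

namespace Summit.Ventures.YMGap.RobustBall

variable {d : ℕ}

/-! ### Generic: summed exponential decay over sets far from the origin -/

/-- **Summed exponential decay over far sets.** If `|G x| ≤ C e^{−m‖x‖_∞}` on `ℤ^d` (`d ≥ 1`, `m > 0`), then for every
`0 < θ < 1`, every real `t` and every finite set `F` of sites with `t ≤ ‖x‖_∞` for `x ∈ F`: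
`Σ_{x∈F} |G x| ≤ max(C,0) · ((1+r)/(1−r))^d · e^{−(1−θ) m t}`, `r = e^{−θm/d}` (split `e^{−m‖x‖} = e^{−(1−θ)m‖x‖} e^{−θm‖x‖}`,
use `‖x‖_∞ ≥ t` in the first factor and `‖x‖_∞ ≥ ‖x‖₁/d` plus rb-p1's `Σ_x r^{‖x‖₁} ≤ ((1+r)/(1−r))^d` in the second).
[folklore] -/
theorem sum_abs_le_of_hasExponentialDecayRate (hd : 1 ≤ d) {G : Site d → ℝ} {m C : ℝ} (hm : 0 < m)
    (hG : ∀ x, |G x| ≤ C * exp (-m * ‖x‖)) {θ : ℝ} (hθ0 : 0 < θ) (hθ1 : θ < 1) (t : ℝ)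
    (F : Finset (Site d)) (hF : ∀ x ∈ F, t ≤ ‖x‖) :
    ∑ x ∈ F, |G x| ≤ max C 0 * ((1 + exp (-(θ * m / d))) / (1 - exp (-(θ * m / d)))) ^ d *
      exp (-((1 - θ) * m) * t) := by
  have hd0 : (0 : ℝ) < d := by exact_mod_cast hd
  set r : ℝ := exp (-(θ * m / d)) with hr
  have hr0 : 0 ≤ r := (exp_pos _).le
  have hr1 : r < 1 := Real.exp_lt_one_iff.2 (neg_neg_of_pos (by positivity))
  have hC : C ≤ max C 0 := le_max_left _ _
  have hC0 : 0 ≤ max C 0 := le_max_right _ _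
  -- pointwise: `|G x| ≤ max(C,0) e^{−(1−θ)mt} r^{‖x‖₁}`
  have hpt : ∀ x ∈ F, |G x| ≤ max C 0 * exp (-((1 - θ) * m) * t) * r ^ l1 x := by
    intro x hx
    have h1 : exp (-m * ‖x‖) = exp (-((1 - θ) * m) * ‖x‖) * exp (-(θ * m) * ‖x‖) := by
      rw [← Real.exp_add]; ring_nf
    have hk : 0 ≤ (1 - θ) * m := mul_nonneg (by linarith) hm.le
    have h2 : exp (-((1 - θ) * m) * ‖x‖) ≤ exp (-((1 - θ) * m) * t) :=
      exp_le_exp.2 (by have := mul_le_mul_of_nonneg_left (hF x hx) hk; linarith)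
    have h3 : exp (-(θ * m) * ‖x‖) ≤ r ^ l1 x := by
      rw [hr, ← Real.exp_nat_mul]
      refine exp_le_exp.2 ?_
      have hl : (l1 x : ℝ) ≤ d * ‖x‖ := l1_le_mul_norm x
      have : (l1 x : ℝ) * (θ * m / d) ≤ θ * m * ‖x‖ := by
        rw [mul_div_assoc', div_le_iff₀ hd0]; nlinarith [mul_pos hθ0 hm]
      linarith
    calc |G x| ≤ C * exp (-m * ‖x‖) := hG x
      _ ≤ max C 0 * exp (-m * ‖x‖) := mul_le_mul_of_nonneg_right hC (exp_pos _).le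
      _ = max C 0 * (exp (-((1 - θ) * m) * ‖x‖) * exp (-(θ * m) * ‖x‖)) := by rw [h1]
      _ ≤ max C 0 * (exp (-((1 - θ) * m) * t) * r ^ l1 x) :=
          mul_le_mul_of_nonneg_left (mul_le_mul h2 h3 (exp_pos _).le (exp_pos _).le) hC0
      _ = max C 0 * exp (-((1 - θ) * m) * t) * r ^ l1 x := by ring
  calc ∑ x ∈ F, |G x| ≤ ∑ x ∈ F, max C 0 * exp (-((1 - θ) * m) * t) * r ^ l1 x := Finset.sum_le_sum hpt
    _ = max C 0 * exp (-((1 - θ) * m) * t) * ∑ x ∈ F, r ^ l1 x := by rw [Finset.mul_sum]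
    _ ≤ max C 0 * exp (-((1 - θ) * m) * t) * ((1 + r) / (1 - r)) ^ d :=
        mul_le_mul_of_nonneg_left (sum_pow_l1_le hr0 hr1 F) (by positivity)
    _ = max C 0 * ((1 + r) / (1 - r)) ^ d * exp (-((1 - θ) * m) * t) := by ring

/-- **Absolute summability over every far set**, same bound: for a set `S` of sites with `t ≤ ‖x‖_∞` on `S`, `x ↦ G x` is
absolutely summable over `S` and `Σ_{x∈S} |G x| ≤ max(C,0) ((1+r)/(1−r))^d e^{−(1−θ) m t}`; in particular
`|Σ_{x∈S} G x|` obeys the same bound. [folklore] -/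
theorem tsum_abs_le_of_hasExponentialDecayRate (hd : 1 ≤ d) {G : Site d → ℝ} {m C : ℝ} (hm : 0 < m)
    (hG : ∀ x, |G x| ≤ C * exp (-m * ‖x‖)) {θ : ℝ} (hθ0 : 0 < θ) (hθ1 : θ < 1) (t : ℝ)
    (S : Set (Site d)) (hS : ∀ x ∈ S, t ≤ ‖x‖) :
    Summable (fun x : S => |G x|) ∧
      ∑' x : S, |G x| ≤ max C 0 * ((1 + exp (-(θ * m / d))) / (1 - exp (-(θ * m / d)))) ^ d *
        exp (-((1 - θ) * m) * t) ∧
      |∑' x : S, G x| ≤ max C 0 * ((1 + exp (-(θ * m / d))) / (1 - exp (-(θ * m / d)))) ^ d *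
        exp (-((1 - θ) * m) * t) := by
  classical
  set B : ℝ := max C 0 * ((1 + exp (-(θ * m / d))) / (1 - exp (-(θ * m / d)))) ^ d * exp (-((1 - θ) * m) * t)
  have hfin : ∀ T : Finset S, ∑ x ∈ T, |G (x : Site d)| ≤ B := by
    intro T
    have h := sum_abs_le_of_hasExponentialDecayRate hd hm hG hθ0 hθ1 t (T.image Subtype.val)
      (fun x hx => by
        obtain ⟨y, _, rfl⟩ := Finset.mem_image.1 hx
        exact hS y y.2)
    rwa [Finset.sum_image (fun x _ y _ h => Subtype.ext h)] at h
  have hsum : Summable (fun x : S => |G x|) := summable_of_sum_le (fun _ => abs_nonneg _) hfin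
  have htsum : ∑' x : S, |G x| ≤ B := Real.tsum_le_of_sum_le (fun _ => abs_nonneg _) hfin
  refine ⟨hsum, htsum, ?_⟩
  calc |∑' x : S, G x| ≤ ∑' x : S, |G x| := by
        have h := norm_tsum_le_tsum_norm (f := fun x : S => G x) (by simpa [Real.norm_eq_abs] using hsum)
        simpa [Real.norm_eq_abs] using h
    _ ≤ B := htsum

/-- On the timeslice `{x : x_i = t}` one has `‖x‖_∞ ≥ |t|`. [folklore] -/
theorem abs_le_norm_of_apply_eq {x : Site d} {i : Fin d} {t : ℤ} (h : x i = t) : (|t| : ℝ) ≤ ‖x‖ := by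
  have h1 := norm_le_pi_norm x i
  rw [h, Int.norm_eq_abs] at h1
  exact_mod_cast h1

/-- **The timeslice sums of an exponentially decaying function decay exponentially**: if `|G x| ≤ C e^{−m‖x‖_∞}` on `ℤ^d`
then for every direction `i`, every `t ∈ ℤ` and every `0 < θ < 1`, `G` is absolutely summable over the slice `{x : x_i = t}`
and `|Σ_{x : x_i = t} G x| ≤ max(C,0) ((1+r)/(1−r))^d e^{−(1−θ) m |t|}`, `r = e^{−θm/d}`. [folklore] -/
theorem timeslice_tsum_abs_le_of_hasExponentialDecayRate (hd : 1 ≤ d) {G : Site d → ℝ} {m C : ℝ} (hm : 0 < m)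
    (hG : ∀ x, |G x| ≤ C * exp (-m * ‖x‖)) {θ : ℝ} (hθ0 : 0 < θ) (hθ1 : θ < 1) (i : Fin d) (t : ℤ) :
    Summable (fun x : {x : Site d // x i = t} => |G x|) ∧
      |∑' x : {x : Site d // x i = t}, G x| ≤
        max C 0 * ((1 + exp (-(θ * m / d))) / (1 - exp (-(θ * m / d)))) ^ d * exp (-((1 - θ) * m) * |t|) := by
  have h := tsum_abs_le_of_hasExponentialDecayRate hd hm hG hθ0 hθ1 (|t| : ℝ) {x : Site d | x i = t}
    (fun x hx => abs_le_norm_of_apply_eq hx)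
  exact ⟨h.1, by exact_mod_cast h.2.2⟩

/-! ### Massive states: the zero-momentum correlator -/

/-- **THE ZERO-MOMENTUM CORRELATOR OF A MASSIVE STATE DECAYS AT EVERY RATE BELOW THE CLUSTERING RATE.** Let `μ` be a state on
the `ℤ⁴` link configurations and `F₁, F₂` bounded measurable gauge-invariant local observables whose truncated correlation
`x ↦ cov_μ(F₁, F₂∘θ_x)` has the exponential decay rate `m` (the clause of `IsMassiveState`). Then for every direction `i`, every
`t ∈ ℤ` and every `0 < θ < 1` the timeslice-summed correlator converges absolutely and
`|Σ_{x : x_i = t} cov_μ(F₁, F₂∘θ_x)| ≤ A ((1+r)/(1−r))⁴ e^{−(1−θ) m |t|}` with the constant `A` of the clause, `r = e^{−θm/4}`.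
[folklore] -/
theorem timeslice_correlator_decay_of_hasExponentialDecayRate {G : Type*} [Group G] [MeasurableSpace G]
    {μ : Measure (LGConfig 4 G)} {F₁ F₂ : LGConfig 4 G → ℝ} {m : ℝ}
    (h : HasExponentialDecayRate (fun x : Site 4 => cov[F₁, fun U => F₂ (configShift x U); μ]) m)
    {θ : ℝ} (hθ0 : 0 < θ) (hθ1 : θ < 1) :
    ∃ A : ℝ, 0 ≤ A ∧ ∀ (i : Fin 4) (t : ℤ),
      Summable (fun x : {x : Site 4 // x i = t} => |cov[F₁, fun U => F₂ (configShift (x : Site 4) U); μ]|) ∧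
      |∑' x : {x : Site 4 // x i = t}, cov[F₁, fun U => F₂ (configShift (x : Site 4) U); μ]| ≤
        A * exp (-((1 - θ) * m) * |t|) := by
  obtain ⟨hm, C, hC⟩ := h
  refine ⟨max C 0 * ((1 + exp (-(θ * m / (4 : ℕ)))) / (1 - exp (-(θ * m / (4 : ℕ))))) ^ 4, ?_, fun i t => ?_⟩
  · have hr1 : exp (-(θ * m / (4 : ℕ))) < 1 := Real.exp_lt_one_iff.2 (neg_neg_of_pos (by positivity))
    have : 0 < 1 - exp (-(θ * m / (4 : ℕ))) := by linarith
    positivity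
  exact timeslice_tsum_abs_le_of_hasExponentialDecayRate (d := 4) (by norm_num) hm hC hθ0 hθ1 i t

/-- **Every MASSIVE STATE has exponentially decaying zero-momentum correlators**: for `IsMassiveState μ` (rate `m`) and all
bounded measurable gauge-invariant local observables `F₁, F₂`, every direction `i` and every `0 < θ < 1` there is `A` with
`|Σ_{x : x_i = t} cov_μ(F₁, F₂∘θ_x)| ≤ A e^{−(1−θ) m |t|}` for all `t ∈ ℤ` (absolutely convergent slice sums). [folklore] -/
theorem timeslice_correlator_decay_of_isMassiveState {G : Type*} [Group G] [MeasurableSpace G]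
    {μ : Measure (LGConfig 4 G)} (hμ : IsMassiveState μ) :
    ∃ m : ℝ, 0 < m ∧ ∀ (F₁ F₂ : LGConfig 4 G → ℝ), IsLocalObservable F₁ → IsLocalObservable F₂ →
      Measurable F₁ → Measurable F₂ → (∃ C, ∀ U, |F₁ U| ≤ C) → (∃ C, ∀ U, |F₂ U| ≤ C) →
      IsZdGaugeInvariant F₁ → IsZdGaugeInvariant F₂ → ∀ θ : ℝ, 0 < θ → θ < 1 →
      ∃ A : ℝ, 0 ≤ A ∧ ∀ (i : Fin 4) (t : ℤ),
        Summable (fun x : {x : Site 4 // x i = t} => |cov[F₁, fun U => F₂ (configShift (x : Site 4) U); μ]|) ∧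
        |∑' x : {x : Site 4 // x i = t}, cov[F₁, fun U => F₂ (configShift (x : Site 4) U); μ]| ≤
          A * exp (-((1 - θ) * m) * |t|) := by
  obtain ⟨m, hm⟩ := hμ
  have hm0 : 0 < m := by
    have h := hm (fun _ => 0) (fun _ => 0) ⟨∅, fun _ _ _ => rfl⟩ ⟨∅, fun _ _ _ => rfl⟩ measurable_const measurable_const
      ⟨0, fun _ => by simp⟩ ⟨0, fun _ => by simp⟩ (fun _ _ => rfl) (fun _ _ => rfl)
    exact h.1
  refine ⟨m, hm0, fun F₁ F₂ hl₁ hl₂ hm₁ hm₂ hb₁ hb₂ hg₁ hg₂ θ hθ0 hθ1 => ?_⟩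
  exact timeslice_correlator_decay_of_hasExponentialDecayRate (hm F₁ F₂ hl₁ hl₂ hm₁ hm₂ hb₁ hb₂ hg₁ hg₂) hθ0 hθ1

/-- **CELL — `SU(2)` on `ℤ⁴`, the whole tier-1 ball**: if `6|β_W| e^{ε₀} + e^{ε₀/2}√(2/3) ε₁ < 1` then EVERY DLR state of
every member `(W, supp) ∈ MemBallZd ε₀ ε₁ R` of the ball around the `SU(2)` Wilson action at `β_W` (tree coupling `β_W/2`) has
exponentially decaying zero-momentum correlators of all bounded measurable gauge-invariant local observables, in every direction,
at every rate below its clustering rate (`su2_isMassiveState_onBallZd_wilson` + `timeslice_correlator_decay_of_isMassiveState`).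
[folklore] -/
theorem su2_timeslice_correlator_decay_onBallZd {βW ε₀ ε₁ : ℝ} (R : ℝ)
    (hρ : 6 * |βW| * Real.exp ε₀ + Real.exp (ε₀ / 2) * Real.sqrt (2 / 3) * ε₁ < 1)
    {W : Potential (ZdEdge 4) (Matrix.specialUnitaryGroup (Fin 2) ℂ)}
    {supp : Finset (ZdEdge 4) → Finset (Finset (ZdEdge 4))} (hmem : MemBallZd ε₀ ε₁ R W supp)
    {μ : Measure (LGConfig 4 (Matrix.specialUnitaryGroup (Fin 2) ℂ))}
    (hμ : μ ∈ perturbedGibbsMeasures (d := 4) (fundamentalRep (Fin 2)) (βW / 2) W supp) :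
    ∃ m : ℝ, 0 < m ∧ ∀ (F₁ F₂ : LGConfig 4 (Matrix.specialUnitaryGroup (Fin 2) ℂ) → ℝ),
      IsLocalObservable F₁ → IsLocalObservable F₂ → Measurable F₁ → Measurable F₂ →
      (∃ C, ∀ U, |F₁ U| ≤ C) → (∃ C, ∀ U, |F₂ U| ≤ C) → IsZdGaugeInvariant F₁ → IsZdGaugeInvariant F₂ →
      ∀ θ : ℝ, 0 < θ → θ < 1 → ∃ A : ℝ, 0 ≤ A ∧ ∀ (i : Fin 4) (t : ℤ),
        Summable (fun x : {x : Site 4 // x i = t} =>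
          |cov[F₁, fun U => F₂ (configShift (x : Site 4) U); μ]|) ∧
        |∑' x : {x : Site 4 // x i = t}, cov[F₁, fun U => F₂ (configShift (x : Site 4) U); μ]| ≤
          A * exp (-((1 - θ) * m) * |t|) :=
  timeslice_correlator_decay_of_isMassiveState ((su2_isMassiveState_onBallZd_wilson R hρ hmem) μ hμ).1

/-- ★ **THE WILSON POINT, EXPLICIT RATE**: for `0 ≤ β_W ≤ 1/12`, EVERY DLR state `μ` of `SU(2)` lattice Yang–Mills on `ℤ⁴` (tree
coupling `β_W/2`) and all bounded measurable local observables `F₁, F₂` (gauge invariance not needed): for every direction `i` and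
every `0 < θ < 1` there is `A` with `|Σ_{x : x_i = t} cov_μ(F₁, F₂∘θ_x)| ≤ A · e^{−(1−θ)(log 2)|t|}` for all `t ∈ ℤ` (absolutely
convergent slice sums) — the zero-momentum correlators decay at every rate below `log 2` per lattice unit (rb-p1's explicit
clustering `su2_wilson_clustering_upTo_oneTwelfth` + ds-3's bridge `perturbed_covariance_decay_of_memBallZd` + the slice sums).
[folklore] -/
theorem su2_wilson_timeslice_correlator_decay_upTo_oneTwelfth {βW : ℝ} (h0 : 0 ≤ βW) (h : βW ≤ 1 / 12)
    {μ : Measure (LGConfig 4 (Matrix.specialUnitaryGroup (Fin 2) ℂ))}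
    (hμ : μ ∈ ymGibbsMeasures (d := 4) (fundamentalRep (Fin 2)) (βW / 2))
    (F₁ F₂ : LGConfig 4 (Matrix.specialUnitaryGroup (Fin 2) ℂ) → ℝ)
    (h₁ : Literature.MathematicalPhysics.QuantumLattice.IsLocalObservable F₁)
    (h₂ : Literature.MathematicalPhysics.QuantumLattice.IsLocalObservable F₂) (h₁m : Measurable F₁) (h₂m : Measurable F₂)
    (hb₁ : ∃ C, ∀ U, |F₁ U| ≤ C) (hb₂ : ∃ C, ∀ U, |F₂ U| ≤ C) {θ : ℝ} (hθ0 : 0 < θ) (hθ1 : θ < 1) :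
    ∃ A : ℝ, 0 ≤ A ∧ ∀ (i : Fin 4) (t : ℤ),
      Summable (fun x : {x : Site 4 // x i = t} => |cov[F₁, fun U => F₂ (configShift (x : Site 4) U); μ]|) ∧
      |∑' x : {x : Site 4 // x i = t}, cov[F₁, fun U => F₂ (configShift (x : Site 4) U); μ]| ≤
        A * exp (-((1 - θ) * Real.log 2) * |t|) := by
  have hβ : (((2 : ℕ) : ℝ) * (βW / 4) : ℝ) = βW / 2 := by push_cast; ring
  have hmem : MemBallZd (N := 2) (0 : ℝ) 0 0 (0 : Potential (ZdEdge 4) (Matrix.specialUnitaryGroup (Fin 2) ℂ))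
      (fun _ => (∅ : Finset (Finset (ZdEdge 4)))) :=
    memBallZd_zero le_rfl le_rfl fun _ _ h => by simp at h
  have hμ' : μ ∈ perturbedGibbsMeasures (d := 4) (fundamentalRep (Fin 2)) ((2 : ℕ) * (βW / 4)) 0
      (fun _ => (∅ : Finset (Finset (ZdEdge 4)))) := by
    rwa [perturbedGibbsMeasures_zero, hβ]
  have hcl := su2_wilson_clustering_upTo_oneTwelfth h0 h μ hμ'
  obtain ⟨C, hC⟩ := perturbed_covariance_decay_of_memBallZd (d := 4) (by norm_num) (by norm_num)
    (((2 : ℕ) : ℝ) * (βW / 4)) hmem hμ' (Real.log_pos (by norm_num))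
    (fun n => ⟨32 * (n : ℝ) ^ 2, fun G₁ G₂ Λ₁ Λ₂ K₁ K₂ hn₁ hn₂ hdis hG₁ hG₂ =>
      hcl n G₁ G₂ Λ₁ Λ₂ K₁ K₂ hn₁ hn₂ hdis hG₁ hG₂⟩) F₁ F₂ h₁ h₂ h₁m h₂m hb₁ hb₂
  exact timeslice_correlator_decay_of_hasExponentialDecayRate ⟨Real.log_pos (by norm_num), C, hC⟩ hθ0 hθ1

/-- **THE TIER-1 BALL, EXPLICIT RATE (C-UNIF ⇒ C-TSLICE)**: if `UniformMassGapOnBallZd 4 N β ε₀ ε₁ R m A` (rb-p1's uniform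
mass gap: ONE rate `m` and ONE constant for every member of `MemBallZd ε₀ ε₁ R` around the `SU(N)` action at 't Hooft `β`),
then for EVERY member, EVERY DLR state `μ` of it, all bounded measurable local `F₁, F₂`, every direction `i` and `0 < θ < 1`
there is `A'` with `|Σ_{x : x_i = t} cov_μ(F₁, F₂∘θ_x)| ≤ A' e^{−(1−θ) m |t|}` for all `t ∈ ℤ`. [folklore] -/
theorem timeslice_correlator_decay_of_uniformMassGapOnBallZd {N : ℕ} (hN : 1 ≤ N) {β ε₀ ε₁ R m A : ℝ}
    (h : UniformMassGapOnBallZd 4 N β ε₀ ε₁ R m A)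
    {W : Potential (ZdEdge 4) (Matrix.specialUnitaryGroup (Fin N) ℂ)}
    {supp : Finset (ZdEdge 4) → Finset (Finset (ZdEdge 4))} (hmem : MemBallZd ε₀ ε₁ R W supp)
    {μ : Measure (LGConfig 4 (Matrix.specialUnitaryGroup (Fin N) ℂ))}
    (hμ : μ ∈ perturbedGibbsMeasures (d := 4) (fundamentalRep (Fin N)) (N * β) W supp)
    (F₁ F₂ : LGConfig 4 (Matrix.specialUnitaryGroup (Fin N) ℂ) → ℝ)
    (h₁ : Literature.MathematicalPhysics.QuantumLattice.IsLocalObservable F₁)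
    (h₂ : Literature.MathematicalPhysics.QuantumLattice.IsLocalObservable F₂) (h₁m : Measurable F₁) (h₂m : Measurable F₂)
    (hb₁ : ∃ C, ∀ U, |F₁ U| ≤ C) (hb₂ : ∃ C, ∀ U, |F₂ U| ≤ C) {θ : ℝ} (hθ0 : 0 < θ) (hθ1 : θ < 1) :
    ∃ A' : ℝ, 0 ≤ A' ∧ ∀ (i : Fin 4) (t : ℤ),
      Summable (fun x : {x : Site 4 // x i = t} => |cov[F₁, fun U => F₂ (configShift (x : Site 4) U); μ]|) ∧
      |∑' x : {x : Site 4 // x i = t}, cov[F₁, fun U => F₂ (configShift (x : Site 4) U); μ]| ≤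
        A' * exp (-((1 - θ) * m) * |t|) := by
  have hcl := (h.2 W supp hmem).2 μ hμ
  obtain ⟨C, hC⟩ := perturbed_covariance_decay_of_memBallZd (d := 4) (by norm_num) hN ((N : ℝ) * β) hmem hμ h.1
    (fun n => ⟨A * (n : ℝ) ^ 2, fun G₁ G₂ Λ₁ Λ₂ K₁ K₂ hn₁ hn₂ hdis hG₁ hG₂ =>
      hcl n G₁ G₂ Λ₁ Λ₂ K₁ K₂ hn₁ hn₂ hdis hG₁ hG₂⟩) F₁ F₂ h₁ h₂ h₁m h₂m hb₁ hb₂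
  exact timeslice_correlator_decay_of_hasExponentialDecayRate ⟨h.1, C, hC⟩ hθ0 hθ1

end Summit.Ventures.YMGap.RobustBall

end
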